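import Literature.MathematicalPhysics.QuantumFieldTheory.YangMillsOS
import HarnessLib

/-!
# Sketch — crux-ideate stmt-QuantumFields-8782 (ContinuumLegGivenGap), ideator 2, round 1

First lemmas of the card `frozen-shape-feynman-hellmann` (they need not be proved here; they must
elaborate over existing declarations).

* `cumulant3` — third joint cumulant of three real observables (support definition).
* `FeynmanHellmannConnectedCorr` — the exact action-insertion identity for the crux's own torus
  two-point function `latticeConnectedCorr`: its `β`-derivative is the sum over torus sites of the
  third cumulant with the translated action density (= `LatticeRep.curvature`'s observable).
* `DoublingWindows` — pure real analysis: an `e^{cβ}/(Kβ)`-type lower bound on a positive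
  function `ξ` forces infinitely many windows of bounded length on which `ξ` doubles.
-/

noncomputable section

open MeasureTheory Filter Topology
open Literature.MathematicalPhysics.QuantumLattice Literature.MathematicalPhysics.QuantumFieldTheory

namespace Summit.QuantumFields.YangMills.Cruxes.ContinuumLegGivenGap.FrozenShape

/-- Third joint cumulant `κ₃(X,Y,W) = E[XYW] − E[XY]E[W] − E[XW]E[Y] − E[YW]E[X] + 2E[X]E[Y]E[W]`
of three real observables under a measure (support definition). -/
def cumulant3 {Ω : Type*} [MeasurableSpace Ω] (μ : Measure Ω) (X Y W : Ω → ℝ) : ℝ :=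
  (∫ u, X u * Y u * W u ∂μ) - (∫ u, X u * Y u ∂μ) * (∫ u, W u ∂μ)
    - (∫ u, X u * W u ∂μ) * (∫ u, Y u ∂μ) - (∫ u, Y u * W u ∂μ) * (∫ u, X u ∂μ)
    + 2 * ((∫ u, X u ∂μ) * (∫ u, Y u ∂μ) * (∫ u, W u ∂μ))

/-- **First lemma (Feynman–Hellmann / action insertion for the torus two-point function).**
`wilsonMeasure ρ β ∝ exp(−β · wilsonAction ρ) · Haar` with `wilsonAction = ∑ₚ (N − Re tr ρ(U_p))`,
and `∑_z actionDensity ρ (τ_{−z} Ũ)` is the sum of `Re tr ρ(U_p)` over all torus plaquettes; hence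
for bounded measurable `A, B` the map `β ↦ latticeConnectedCorr ρ β S A B n` is differentiable with
derivative `∑_{z ∈ torus} κ₃(A, τ_{n e₀}B, actionDensity at z)`. Provable now (differentiation under
the integral on the compact configuration space; `hasDerivAt_integral_of_dominated_loc_of_deriv_le`). -/
def FeynmanHellmannConnectedCorr : Prop :=
  ∀ (G : Type) [Group G] [TopologicalSpace G] [IsTopologicalGroup G] [CompactSpace G]
    [MeasurableSpace G] [BorelSpace G] (N : ℕ) (ρ : G →* Matrix (Fin N) (Fin N) ℂ), Continuous ρ →
    ∀ (S : ℕ) [NeZero S] (A B : LGConfig 4 G → ℝ), Measurable A → Measurable B →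
      (∃ C : ℝ, ∀ U, |A U| ≤ C) → (∃ C : ℝ, ∀ U, |B U| ≤ C) → ∀ (n : ℕ) (β : ℝ),
        HasDerivAt (fun b : ℝ => latticeConnectedCorr ρ b S A B n)
          (∑ z : Literature.MathematicalPhysics.QuantumFieldTheory.Site 4 S,
            cumulant3 (wilsonMeasure (d := 4) (L := S) ρ β)
              (fun U => A (torusLift S U))
              (fun U => B (configShift (-Pi.single 0 (n : ℤ)) (torusLift S U)))
              (fun U => actionDensity ρ (configShift (-(fun i => ((z i).val : ℤ))) (torusLift S U))))
          β

/-- **Doubling windows (pure real analysis, provable now).** If `ξ(β) ≥ e^{cβ}/(Kβ)` for all large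
`β` (the shape of `XiCompleteMonotonicity.XiExpLowerBound`) then for `B := 2·log 2 / c` there are
arbitrarily large `β` with `ξ(β + B) ≥ 2·ξ(β)` — otherwise `ξ(β₀ + jB) < 2^j ξ(β₀)` grows only like
`e^{(c/2)β}`, contradiction. This is the coupling window over which the card integrates the
Feynman–Hellmann identity. -/
def DoublingWindows : Prop :=
  ∀ (ξ : ℝ → ℝ) (c K β₁ : ℝ), 0 < c → 0 < K → (∀ β, β₁ ≤ β → 0 < ξ β) →
    (∀ β, β₁ ≤ β → Real.exp (c * β) / (K * β) ≤ ξ β) →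
      ∀ β₂ : ℝ, ∃ β : ℝ, β₂ ≤ β ∧ 2 * ξ β ≤ ξ (β + 2 * Real.log 2 / c)

end Summit.QuantumFields.YangMills.Cruxes.ContinuumLegGivenGap.FrozenShape

end
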